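import Mathlib
import Literature.AlgebraicGeometry.Resolution.CobordantGame
import Summits.ResolutionOfSingularities.ResolutionOfSingularities.Theorems.WeightedInvariantLocalWeightedDropTwistedTrivialOrderDrop
import Summits.ResolutionOfSingularities.ResolutionOfSingularities.Theorems.WeightedInvariantLocalWeightedDropTwistedTrivialSanity

/-!
# `WeightedInvariant.LocalWeightedDrop`: THE ORDER OBSTRUCTION for origin-fixing twisted triviality (§9 R4-1/R4-2)

Route `ResolutionOfSingularities/WeightedInvariant`, crux `LocalWeightedDrop`
(stmt-ResolutionOfSingularities-8899).  [OURS · L1 W4.3] — §9 (Round 4) R4-1 and R4-2 of ideator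
res-L1-w43-idea-1's `Sketch-L1-idea-1.lean` v4 (2026-08-27), for a GENERAL formal curve `γ` and EVERY
Frobenius exponent.  Nothing here is a statement of the manuscript under review on ladder RESOLUTION;
AI-produced, weaker than expert review.

DICTIONARY.  The sketch's v4 predicate `TwistedTrivialAlong` (v3 + the origin-fixing clause
`pureSigma (Φ j) = 0`) is, conjunct for conjunct, the tree's `GradedGame.TwistedTrivialAlongFix`
(`…TwistedCylinder`): `twistedTrivialAlongFix_iff_pureSigma` (`Iff.rfl`).  The v3 predicate AS TYPED (tree
`GradedGame.TwistedTrivialAlong` ⟺ `γ(0) = 0`) does NOT satisfy R4-1: `not_xOrderGE_translateAlong_X_sq`.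
* `XOrderGE`, `OrderGE`, `translateAlong` — the sketch's §9 vocabulary, verbatim.
* `xOrderGE_translateAlong_iff` — the `x`-order condition of `f(x + γ(σ^{p^e}))` does not depend on `e`
  (`translateAlong p e = (σ ↦ σ^{p^e}) ∘ translateAlong p 0`; the `σ`-expansion is injective on monomials and
  preserves `x`-degrees).
* R4-1 `xOrderGE_of_twistedTrivialAlongFix` (sketch `stub_xOrderGE_of_twistedTrivial`, signature verbatim up
  to the predicate's tree name): `f ∈ 𝔪^N` twisted-trivial along `γ` ⇒ EVERY translate has `x`-order `≥ N`
  over `k⟦σ⟧`: for the witness exponent `e₀`, `f(x + γ(σ^{p^{e₀}})) = u · f(Φ)` has `x`-weighted order `≥ N`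
  (`le_weightedOrder_subst_of_fix`, `…TwistedTrivialOrderDrop`); then move `e₀ ↦ e`.
* R4-2 (rule-free) `not_twistedTrivialAlongFix_of_lowXOrder_translate` / `…_axis_of_lowOrder_translate`: ONE
  monomial of `x`-degree `< N` in ONE translate excludes twisted triviality; the sketch's `i ∉ satSet p f`
  form is a one-liner once the §8 rule object `satSet` is typed (plan seat's object, not landed here).
-/

set_option linter.dupNamespace false -- mandated namespace of this single-conjunct summit
set_option autoImplicit false

namespace Summit.ResolutionOfSingularities.ResolutionOfSingularities.Theorems

namespace GradedGame

open MvPowerSeries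
open Literature.AlgebraicGeometry.Resolution

variable {k : Type} [Field k]

/-! ## Sketch v4 vocabulary (verbatim) and the dictionary with the tree predicate -/

/-- The pure-`σ` part of a series in `σ = X 0, x₁ = X 1, …, xₙ = X n`: substitute `xⱼ ↦ 0`.  `pureSigma Φ = 0`
says `Φ(σ, 0) = 0`, i.e. the automorphism FIXES THE ORIGIN of the `x`-space for every `σ`.
[OURS · L1 W4.3, Sketch-L1-idea-1 v4 §1 — VERBATIM] -/
noncomputable def pureSigma {n : ℕ} (Φ : MvPowerSeries (Fin (n + 1)) k) : MvPowerSeries (Fin (n + 1)) k :=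
  subst (fun v : Fin (n + 1) => if v = 0 then (X (0 : Fin (n + 1)) : MvPowerSeries (Fin (n + 1)) k) else 0) Φ

/-- DICTIONARY: the tree's origin-fixing predicate `TwistedTrivialAlongFix` IS the sketch's v4
`TwistedTrivialAlong` (v3 clauses + `∀ j, pureSigma (Φ j) = 0`), definitionally. [OURS · L1 W4.3] -/
theorem twistedTrivialAlongFix_iff_pureSigma (p : ℕ) {n : ℕ} (f : MvPowerSeries (Fin n) k)
    (γ : Fin n → MvPowerSeries (Fin 1) k) :
    TwistedTrivialAlongFix p f γ ↔
      (∀ i, constantCoeff (γ i) = 0) ∧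
      ∃ (e : ℕ) (Φ : Fin n → MvPowerSeries (Fin (n + 1)) k) (u : MvPowerSeries (Fin (n + 1)) k),
        IsUnit u ∧ (∀ j, constantCoeff (Φ j) = 0) ∧ (∀ j, pureSigma (Φ j) = 0) ∧
        IsUnit (Matrix.det (Matrix.of fun i j : Fin n => coeff (Finsupp.single j.succ 1) (Φ i))) ∧
        subst (fun i : Fin n => X i.succ + subst (fun _ : Fin 1 => X (0 : Fin (n + 1)) ^ (p ^ e)) (γ i)) f
          = u * subst Φ f :=
  Iff.rfl

/-- `x`-ORDER at least `N` over `k⟦σ⟧`: every monomial of `F ∈ k⟦σ, x₁..xₙ⟧` has total `x`-degree `≥ N`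
(`σ = X 0` not counted). [OURS · L1 W4.3, Sketch-L1-idea-1 v4 §9 — VERBATIM] -/
def XOrderGE {n : ℕ} (N : ℕ) (F : MvPowerSeries (Fin (n + 1)) k) : Prop :=
  ∀ m : Fin (n + 1) →₀ ℕ, coeff m F ≠ 0 → N ≤ ∑ i : Fin n, m i.succ

/-- Total order at least `N` for `f ∈ k⟦x₁..xₙ⟧`. [OURS · L1 W4.3, Sketch-L1-idea-1 v4 §9 — VERBATIM] -/
def OrderGE {n : ℕ} (N : ℕ) (f : MvPowerSeries (Fin n) k) : Prop :=
  ∀ m : Fin n →₀ ℕ, coeff m f ≠ 0 → N ≤ ∑ i : Fin n, m i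

/-- The translate of `f` along `γ` with Frobenius exponent `p^e` (the left-hand side of the twisted-triviality
predicates). [OURS · L1 W4.3, Sketch-L1-idea-1 v4 §9 — VERBATIM] -/
noncomputable def translateAlong (p e : ℕ) {n : ℕ} (f : MvPowerSeries (Fin n) k)
    (γ : Fin n → MvPowerSeries (Fin 1) k) : MvPowerSeries (Fin (n + 1)) k :=
  subst (fun i : Fin n => X i.succ + subst (fun _ : Fin 1 => X (0 : Fin (n + 1)) ^ (p ^ e)) (γ i)) f

/-- The `x`-weight of an exponent (weight `0` on `σ`, `1` on the `x`-variables) is its total `x`-degree.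
[OURS · L1 W4.3] -/
theorem weight_xWeight {n : ℕ} (m : Fin (n + 1) →₀ ℕ) :
    Finsupp.weight (xWeight n) m = ∑ i : Fin n, m i.succ := by
  rw [Finsupp.weight_apply, Finsupp.sum_fintype _ _ (fun _ => by simp), Fin.sum_univ_succ]
  simp [xWeight, Fin.succ_ne_zero]

/-- `XOrderGE N F` is `N ≤` the `x`-weighted order of `F`. [OURS · L1 W4.3] -/
theorem xOrderGE_iff_le_weightedOrder {n : ℕ} (N : ℕ) (F : MvPowerSeries (Fin (n + 1)) k) :
    XOrderGE N F ↔ (N : ℕ∞) ≤ weightedOrder (xWeight n) F := by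
  constructor
  · intro h
    apply le_weightedOrder
    intro d hd
    by_contra hne
    have h1 := h d hne
    rw [← weight_xWeight] at h1
    have h2 : Finsupp.weight (xWeight n) d < N := by exact_mod_cast hd
    omega
  · intro h m hm
    rw [← weight_xWeight]
    have := (weightedOrder_le (w := xWeight n) hm)
    exact_mod_cast h.trans this

/-- `OrderGE N f` is `f ∈ 𝔪^N` in the exponent form used by `…TwistedTrivialOrderDrop`. [OURS · L1 W4.3] -/
theorem orderGE_iff_degree {n : ℕ} (N : ℕ) (f : MvPowerSeries (Fin n) k) :
    OrderGE N f ↔ ∀ d : Fin n →₀ ℕ, coeff d f ≠ 0 → N ≤ d.degree := by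
  simp only [OrderGE, Finsupp.degree_eq_sum]

/-! ## Substitutions by monomials: coefficients -/

section MonomialSubst

variable {N M : ℕ} (ρ : Fin N → (Fin M →₀ ℕ))

/-- The exponent of the image of `x^d` under `X v ↦ x^{ρ v}`. [OURS · L1 W4.3] -/
noncomputable def linExp (d : Fin N →₀ ℕ) : Fin M →₀ ℕ :=
  d.sum fun v e => e • ρ v

/-- Components of the image exponent. [OURS · L1 W4.3] -/
theorem linExp_apply (d : Fin N →₀ ℕ) (u : Fin M) : linExp ρ d u = d.sum fun v e => e * ρ v u := by
  unfold linExp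
  rw [Finsupp.sum_apply]
  exact Finsupp.sum_congr fun j _ => by simp

/-- The image of the monomial `x^d` under `X v ↦ x^{ρ v}`. [OURS · L1 W4.3] -/
theorem prod_pow_monomial_linExp (d : Fin N →₀ ℕ) :
    (d.prod fun v e => (monomial (ρ v) (1 : k) : MvPowerSeries (Fin M) k) ^ e) = monomial (linExp ρ d) 1 := by
  unfold Finsupp.prod linExp
  simp_rw [monomial_pow, one_pow]
  rw [prod_monomial, Finset.prod_const_one]
  rfl

/-- A family of non-constant monomials is substitutable. [OURS · L1 W4.3] -/
theorem hasSubst_monomial (hρ : ∀ v, ρ v ≠ 0) :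
    HasSubst (fun v => (monomial (ρ v) (1 : k) : MvPowerSeries (Fin M) k)) := by
  classical
  exact hasSubst_of_constantCoeff_zero fun v => by
    rw [← coeff_zero_eq_constantCoeff_apply, coeff_monomial, if_neg (Ne.symm (hρ v))]

/-- Coefficient of a monomial substitution AT AN IMAGE EXPONENT (injective exponent map). [OURS · L1 W4.3] -/
theorem coeff_linExp_subst_monomial (hρs : HasSubst (fun v => (monomial (ρ v) (1 : k) : MvPowerSeries (Fin M) k)))
    (hinj : Function.Injective (linExp ρ)) (f : MvPowerSeries (Fin N) k) (d : Fin N →₀ ℕ) :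
    coeff (linExp ρ d) (subst (fun v => (monomial (ρ v) (1 : k) : MvPowerSeries (Fin M) k)) f) = coeff d f := by
  classical
  rw [coeff_subst hρs, finsum_eq_single _ d]
  · rw [prod_pow_monomial_linExp, coeff_monomial_same, smul_eq_mul, mul_one]
  · intro d' hd'
    rw [prod_pow_monomial_linExp, coeff_monomial_ne, smul_zero]
    exact fun h => hd' (hinj h).symm

/-- Coefficient of a monomial substitution OFF THE IMAGE of the exponent map. [OURS · L1 W4.3] -/
theorem coeff_subst_monomial_eq_zero (hρs : HasSubst (fun v => (monomial (ρ v) (1 : k) : MvPowerSeries (Fin M) k)))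
    (f : MvPowerSeries (Fin N) k) (μ : Fin M →₀ ℕ) (hμ : ∀ d, linExp ρ d ≠ μ) :
    coeff μ (subst (fun v => (monomial (ρ v) (1 : k) : MvPowerSeries (Fin M) k)) f) = 0 := by
  classical
  rw [coeff_subst hρs]
  apply finsum_eq_zero_of_forall_eq_zero
  intro d
  rw [prod_pow_monomial_linExp, coeff_monomial_ne (Ne.symm (hμ d)), smul_zero]

end MonomialSubst

/-! ## The `σ`-expansion `σ ↦ σ^q`, `xⱼ ↦ xⱼ` -/

section SigmaExpand

variable (n q : ℕ)

/-- Exponents of the `σ`-expansion: `σ ↦ σ^q`, `xⱼ ↦ xⱼ`. [OURS · L1 W4.3] -/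
noncomputable def sigmaExp : Fin (n + 1) → (Fin (n + 1) →₀ ℕ) :=
  fun v => if v = 0 then Finsupp.single 0 q else Finsupp.single v 1

/-- The `σ`-expansion family `σ ↦ σ^q`, `xⱼ ↦ xⱼ` (as monomials). [OURS · L1 W4.3] -/
noncomputable def sigmaExpand : Fin (n + 1) → MvPowerSeries (Fin (n + 1)) k :=
  fun v => monomial (sigmaExp n q v) 1

/-- `σ ↦ σ^q`. [OURS · L1 W4.3] -/
theorem sigmaExpand_zero : sigmaExpand (k := k) n q 0 = X 0 ^ q := by
  simp [sigmaExpand, sigmaExp, X_pow_eq]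

/-- `xⱼ ↦ xⱼ`. [OURS · L1 W4.3] -/
theorem sigmaExpand_succ (j : Fin n) : sigmaExpand (k := k) n q j.succ = X j.succ := by
  simp [sigmaExpand, sigmaExp, Fin.succ_ne_zero, X_def]

variable {n q}

/-- The `σ`-expansion is substitutable for `q ≠ 0`. [OURS · L1 W4.3] -/
theorem hasSubst_sigmaExpand (hq : q ≠ 0) : HasSubst (sigmaExpand (k := k) n q) :=
  hasSubst_monomial _ fun v => by
    unfold sigmaExp
    split_ifs
    · exact (Finsupp.single_ne_zero).mpr hq
    · exact (Finsupp.single_ne_zero).mpr one_ne_zero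

/-- The `σ`-component of an expanded exponent is `q · d₀`. [OURS · L1 W4.3] -/
theorem linExp_sigmaExp_zero (d : Fin (n + 1) →₀ ℕ) : linExp (sigmaExp n q) d 0 = d 0 * q := by
  classical
  rw [linExp_apply, Finsupp.sum]
  have : ∀ v ∈ d.support, d v * sigmaExp n q v 0 = if v = 0 then d v * q else 0 := by
    intro v _
    unfold sigmaExp
    by_cases hv : v = 0
    · subst hv; simp
    · simp [hv, Ne.symm hv]
  rw [Finset.sum_congr rfl this, Finset.sum_ite_eq']
  split_ifs with h0
  · rfl
  · rw [Finsupp.notMem_support_iff.mp h0, zero_mul]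

/-- The `xⱼ`-components of an expanded exponent are unchanged. [OURS · L1 W4.3] -/
theorem linExp_sigmaExp_succ (d : Fin (n + 1) →₀ ℕ) (j : Fin n) : linExp (sigmaExp n q) d j.succ = d j.succ := by
  classical
  rw [linExp_apply, Finsupp.sum]
  have : ∀ v ∈ d.support, d v * sigmaExp n q v j.succ = if v = j.succ then d v else 0 := by
    intro v _
    unfold sigmaExp
    by_cases hv : v = 0
    · subst hv
      simp [Fin.succ_ne_zero, (Fin.succ_ne_zero j).symm]
    · rw [if_neg hv]
      by_cases hvj : v = j.succ
      · subst hvj; simp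
      · simp [hvj, Ne.symm hvj]
  rw [Finset.sum_congr rfl this, Finset.sum_ite_eq']
  split_ifs with h0
  · rfl
  · exact (Finsupp.notMem_support_iff.mp h0).symm

/-- The expanded exponent has the same `x`-degree. [OURS · L1 W4.3] -/
theorem xDegree_linExp_sigmaExp (d : Fin (n + 1) →₀ ℕ) :
    ∑ i : Fin n, linExp (sigmaExp n q) d i.succ = ∑ i : Fin n, d i.succ :=
  Finset.sum_congr rfl fun i _ => linExp_sigmaExp_succ d i

/-- The exponent map of the `σ`-expansion is injective for `q ≠ 0`. [OURS · L1 W4.3] -/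
theorem linExp_sigmaExp_injective (hq : q ≠ 0) : Function.Injective (linExp (sigmaExp n q)) := by
  intro d d' h
  ext v
  refine Fin.cases ?_ (fun j => ?_) v
  · have := congrArg (fun θ => θ 0) h
    simp only [linExp_sigmaExp_zero] at this
    exact Nat.eq_of_mul_eq_mul_right (Nat.pos_of_ne_zero hq) this
  · have := congrArg (fun θ => θ j.succ) h
    simpa only [linExp_sigmaExp_succ] using this

/-- The `x`-ORDER CONDITION IS INVARIANT under the `σ`-expansion `σ ↦ σ^q` (`q ≠ 0`). [OURS · L1 W4.3] -/
theorem xOrderGE_subst_sigmaExpand_iff (hq : q ≠ 0) (N : ℕ) (F : MvPowerSeries (Fin (n + 1)) k) :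
    XOrderGE N (subst (sigmaExpand (k := k) n q) F) ↔ XOrderGE N F := by
  have hS : HasSubst (fun v => (monomial (sigmaExp n q v) (1 : k) : MvPowerSeries (Fin (n + 1)) k)) :=
    hasSubst_sigmaExpand (k := k) (n := n) hq
  have hSE : (sigmaExpand (k := k) n q) = fun v => (monomial (sigmaExp n q v) (1 : k) : MvPowerSeries (Fin (n + 1)) k) :=
    rfl
  rw [hSE]
  constructor
  · intro h d hd
    have hc : coeff (linExp (sigmaExp n q) d)
        (subst (fun v => (monomial (sigmaExp n q v) (1 : k) : MvPowerSeries (Fin (n + 1)) k)) F) ≠ 0 := by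
      rw [coeff_linExp_subst_monomial (sigmaExp n q) hS (linExp_sigmaExp_injective hq) F d]
      exact hd
    have := h _ hc
    rwa [xDegree_linExp_sigmaExp] at this
  · intro h μ hμ
    obtain ⟨d, rfl⟩ : ∃ d, linExp (sigmaExp n q) d = μ := by
      by_contra hno
      push Not at hno
      exact hμ (coeff_subst_monomial_eq_zero (sigmaExp n q) hS F μ hno)
    rw [xDegree_linExp_sigmaExp]
    apply h d
    intro h0
    apply hμ
    rw [coeff_linExp_subst_monomial (sigmaExp n q) hS (linExp_sigmaExp_injective hq) F d, h0]

end SigmaExpand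

/-- The translation family along `γ` with parameter `σ^q` is substitutable (`q ≠ 0`, `γ(0) = 0`).
[OURS · L1 W4.3] -/
theorem hasSubst_translateFamily {n : ℕ} (q : ℕ) (hq : q ≠ 0) (γ : Fin n → MvPowerSeries (Fin 1) k)
    (hγ : ∀ i, constantCoeff (γ i) = 0) :
    HasSubst (fun i : Fin n => X i.succ + subst (fun _ : Fin 1 => (X (0 : Fin (n + 1)) : MvPowerSeries (Fin (n + 1)) k) ^ q)
      (γ i)) := by
  have ha : HasSubst (fun _ : Fin 1 => (X (0 : Fin (n + 1)) : MvPowerSeries (Fin (n + 1)) k) ^ q) :=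
    hasSubst_of_constantCoeff_zero fun _ => by simp [constantCoeff_X, zero_pow hq]
  exact hasSubst_of_constantCoeff_zero fun i => by
    rw [map_add, constantCoeff_X, zero_add]
    exact constantCoeff_subst_eq_zero ha (fun _ => by simp [constantCoeff_X, zero_pow hq]) (hγ i)

/-- CHANGING THE FROBENIUS EXPONENT IS A `σ`-EXPANSION: `f(x + γ(σ^{p^e})) = (σ ↦ σ^{p^e}) · f(x + γ(σ))`.
[OURS · L1 W4.3] -/
theorem translateAlong_eq_subst_sigmaExpand (p e : ℕ) (hp : p ≠ 0) {n : ℕ} (f : MvPowerSeries (Fin n) k)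
    (γ : Fin n → MvPowerSeries (Fin 1) k) (hγ : ∀ i, constantCoeff (γ i) = 0) :
    translateAlong p e f γ = subst (sigmaExpand n (p ^ e)) (translateAlong p 0 f γ) := by
  have hq : p ^ e ≠ 0 := pow_ne_zero e hp
  have hS := hasSubst_sigmaExpand (k := k) (n := n) hq
  have h1 : HasSubst (fun _ : Fin 1 => (X (0 : Fin (n + 1)) : MvPowerSeries (Fin (n + 1)) k) ^ (p ^ 0)) :=
    hasSubst_of_constantCoeff_zero fun _ => by simp [constantCoeff_X]
  have hT0 := hasSubst_translateFamily (k := k) (p ^ 0) (by simp) γ hγ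
  unfold translateAlong
  rw [subst_comp_subst_apply hT0 hS]
  congr 1
  funext i
  rw [subst_add hS, subst_X hS, sigmaExpand_succ, subst_comp_subst_apply h1 hS]
  congr 1
  congr 1
  funext j
  rw [subst_pow hS, subst_X hS, sigmaExpand_zero, pow_zero, pow_one]

/-- THE `x`-ORDER CONDITION OF THE TRANSLATE DOES NOT DEPEND ON THE FROBENIUS EXPONENT. [OURS · L1 W4.3] -/
theorem xOrderGE_translateAlong_iff (p : ℕ) (hp : p ≠ 0) {n : ℕ} (N : ℕ) (f : MvPowerSeries (Fin n) k)
    (γ : Fin n → MvPowerSeries (Fin 1) k) (hγ : ∀ i, constantCoeff (γ i) = 0) (e e' : ℕ) :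
    XOrderGE N (translateAlong p e f γ) ↔ XOrderGE N (translateAlong p e' f γ) := by
  rw [translateAlong_eq_subst_sigmaExpand p e hp f γ hγ, translateAlong_eq_subst_sigmaExpand p e' hp f γ hγ,
    xOrderGE_subst_sigmaExpand_iff (pow_ne_zero e hp), xOrderGE_subst_sigmaExpand_iff (pow_ne_zero e' hp)]

/-- R4-1 — THE ORDER OBSTRUCTION.  If `f ∈ 𝔪^N` is twisted-trivial along `γ` in the ORIGIN-FIXING sense
(`TwistedTrivialAlongFix` = Sketch v4 `TwistedTrivialAlong`), then EVERY translate `f(x + γ(σ^{p^e}))` keeps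
`x`-order `≥ N` over `k⟦σ⟧` (`p ≠ 0`).  An origin-fixing `Φ` maps `(x)^N` into `(x)^N` and units preserve the
`x`-weighted order; the exponent is then moved by `xOrderGE_translateAlong_iff`. [OURS · L1 W4.3,
Sketch-L1-idea-1 v4 §9 R4-1] -/
theorem xOrderGE_of_twistedTrivialAlongFix (p : ℕ) (hp : p ≠ 0) {n : ℕ} (N : ℕ) (f : MvPowerSeries (Fin n) k)
    (γ : Fin n → MvPowerSeries (Fin 1) k) (hf : OrderGE N f) (h : TwistedTrivialAlongFix p f γ) (e : ℕ) :
    XOrderGE N (translateAlong p e f γ) := by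
  obtain ⟨hγ, e₀, Φ, u, -, hΦ0, hfix, -, heq⟩ := h
  rw [xOrderGE_translateAlong_iff p hp N f γ hγ e e₀, xOrderGE_iff_le_weightedOrder]
  have hΦs : HasSubst Φ := hasSubst_of_constantCoeff_zero hΦ0
  have hfixw : ∀ j, ∀ d, coeff d (Φ j) ≠ 0 → 1 ≤ Finsupp.weight (xWeight n) d :=
    fun j d hd => one_le_weight_of_fix (Φ j) (hfix j) d hd
  have hM : ∀ d, coeff d f ≠ 0 → N ≤ d.degree := (orderGE_iff_degree N f).mp hf
  have hE : translateAlong p e₀ f γ = u * subst Φ f := heq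
  rw [hE]
  calc (N : ℕ∞) ≤ weightedOrder (xWeight n) (subst Φ f) := le_weightedOrder_subst_of_fix hΦs hfixw f N hM
    _ ≤ weightedOrder (xWeight n) u + weightedOrder (xWeight n) (subst Φ f) := le_add_self
    _ ≤ weightedOrder (xWeight n) (u * subst Φ f) := le_weightedOrder_mul _

/-- R4-1 with the sketch's hypothesis `1 < p` (signature of `stub_xOrderGE_of_twistedTrivial` verbatim up to the
predicate's tree name `TwistedTrivialAlongFix`). [OURS · L1 W4.3, Sketch-L1-idea-1 v4 §9 R4-1] -/
theorem stub_xOrderGE_of_twistedTrivialFix (p : ℕ) (hp : 1 < p) {n : ℕ} (N : ℕ) (f : MvPowerSeries (Fin n) k)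
    (γ : Fin n → MvPowerSeries (Fin 1) k) (hf : OrderGE N f) (h : TwistedTrivialAlongFix p f γ) (e : ℕ) :
    XOrderGE N (translateAlong p e f γ) :=
  xOrderGE_of_twistedTrivialAlongFix p (by omega) N f γ hf h e

/-! ## R4-2 (rule-free): one low monomial of one translate excludes twisted triviality -/

/-- R4-2, general curve: if `f ∈ 𝔪^N` and SOME translate `f(x + γ(σ^{p^e}))` has a monomial of `x`-degree
`< N`, then `f` is not twisted-trivial along `γ` in the origin-fixing sense. [OURS · L1 W4.3] -/
theorem not_twistedTrivialAlongFix_of_lowXOrder_translate (p : ℕ) (hp : p ≠ 0) {n : ℕ} (N : ℕ)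
    (f : MvPowerSeries (Fin n) k) (γ : Fin n → MvPowerSeries (Fin 1) k) (hf : OrderGE N f) (e : ℕ)
    (m : Fin (n + 1) →₀ ℕ) (hm : coeff m (translateAlong p e f γ) ≠ 0) (hdeg : ∑ j : Fin n, m j.succ < N) :
    ¬ TwistedTrivialAlongFix p f γ := fun h => by
  have := xOrderGE_of_twistedTrivialAlongFix p hp N f γ hf h e m hm
  omega

/-- R4-2, axis form (the sketch's `not_mem_satSet_of_lowOrder_translate` with its conclusion `i ∉ satSet p f`
unfolded to `¬ TwistedTrivialAlong(Fix) p f (axisCurve i)`): an axis direction along which some translate of a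
germ of order `≥ 2` has a monomial of `x`-degree `≤ 1` (the translated point is smooth or off the hypersurface)
is not twisted-trivial. [OURS · L1 W4.3, Sketch-L1-idea-1 v4 §9 R4-2] -/
theorem not_twistedTrivialAlongFix_axis_of_lowOrder_translate (p : ℕ) (hp : 1 < p) {n : ℕ}
    (f : MvPowerSeries (Fin n) k) (hf : OrderGE 2 f) (i : Fin n) (e : ℕ) (m : Fin (n + 1) →₀ ℕ)
    (hm : coeff m (translateAlong p e f (axisCurve i)) ≠ 0) (hdeg : ∑ j : Fin n, m j.succ ≤ 1) :
    ¬ TwistedTrivialAlongFix p f (axisCurve i) :=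
  not_twistedTrivialAlongFix_of_lowXOrder_translate p (by omega) 2 f (axisCurve i) hf e m hm (by omega)

/-- CONTROL.  For the v3 predicate AS TYPED (tree `TwistedTrivialAlong`, equivalent to `γ(0) = 0`) the order
obstruction FAILS: `x²` has order `2`, is twisted-trivial along its own axis as typed, and its translate
`(x + σ^{p^e})²` carries the monomial `σ^{2p^e}` of `x`-degree `0`.  So R4-1 genuinely uses the origin-fixing
clause. [OURS · L1 W4.3] -/
theorem not_xOrderGE_translateAlong_X_sq (p e : ℕ) (hp : p ≠ 0) :
    OrderGE 2 ((X (0 : Fin 1)) ^ 2 : MvPowerSeries (Fin 1) k) ∧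
      TwistedTrivialAlong p ((X (0 : Fin 1)) ^ 2 : MvPowerSeries (Fin 1) k) (axisCurve 0) ∧
      ¬ XOrderGE 2 (translateAlong p e ((X (0 : Fin 1)) ^ 2 : MvPowerSeries (Fin 1) k) (axisCurve 0)) := by
  classical
  have hq : p ^ e ≠ 0 := pow_ne_zero e hp
  refine ⟨?_, twistedTrivialAlong_axisCurve p _ 0, ?_⟩
  · intro m hm
    rw [coeff_X_pow] at hm
    split_ifs at hm with h; · subst h; simp
    exact absurd rfl hm
  · intro hX
    -- the translate is `(x₁ + σ^{p^e})²`; its coefficient at `σ^{2 p^e}` is `1`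
    have ha : HasSubst (fun _ : Fin 1 => (X (0 : Fin (1 + 1)) : MvPowerSeries (Fin (1 + 1)) k) ^ (p ^ e)) :=
      hasSubst_of_constantCoeff_zero fun _ => by simp [constantCoeff_X, zero_pow hq]
    have hγ : ∀ i, constantCoeff (axisCurve (k := k) (0 : Fin 1) i) = 0 := fun i => by
      unfold axisCurve; split_ifs <;> simp [constantCoeff_X]
    have hT := hasSubst_translateFamily (k := k) (p ^ e) hq (axisCurve (0 : Fin 1)) hγ
    have hE : translateAlong p e ((X (0 : Fin 1)) ^ 2 : MvPowerSeries (Fin 1) k) (axisCurve 0) =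
        (X (Fin.succ 0) + X 0 ^ (p ^ e)) ^ 2 := by
      unfold translateAlong
      rw [subst_pow hT, subst_X hT]
      simp only [axisCurve, if_true, subst_X ha]
    have hc : coeff (Finsupp.single (0 : Fin (1 + 1)) (2 * p ^ e))
        (translateAlong p e ((X (0 : Fin 1)) ^ 2 : MvPowerSeries (Fin 1) k) (axisCurve 0)) = 1 := by
      have hsplit : (X (Fin.succ 0) + X 0 ^ (p ^ e) : MvPowerSeries (Fin (1 + 1)) k) ^ 2 =
          X (Fin.succ 0) * (X (Fin.succ 0) + 2 * X 0 ^ (p ^ e)) + X 0 ^ (2 * p ^ e) := by ring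
      rw [hE, hsplit, map_add, X_dvd_iff.mp (dvd_mul_right _ _) _ (by simp), zero_add, coeff_X_pow, if_pos rfl]
    have := hX (Finsupp.single (0 : Fin (1 + 1)) (2 * p ^ e)) (by rw [hc]; exact one_ne_zero)
    simp [Fin.succ_ne_zero] at this

end GradedGame

end Summit.ResolutionOfSingularities.ResolutionOfSingularities.Theorems
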